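import Literature.NumberTheory.EllipticCurves.CuspFormLFunctionLevelConductorProofs
import Literature.NumberTheory.EllipticCurves.ModularCurveManinSemistableBridgeProofs
import Literature.NumberTheory.EllipticCurves.GlobalMinimalModelProofs
import Literature.NumberTheory.EllipticCurves.IsogenyVariableChangeProofs
import Literature.NumberTheory.EllipticCurves.IsogenyCompProofs
import Literature.NumberTheory.EllipticCurves.SzpiroOfAbcProofs
import HarnessLib

/-!
# `ℚ`-isogenous elliptic curves have the same conductor — from modularity and multiplicity one

Topic `Literature/NumberTheory/EllipticCurves`; a proofs-only file (theorems only: no definition, no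
named fact; D-0026). The isogeny invariance of the conductor `N_E` of an elliptic curve `E/ℚ`
(Silverman, *ATAEC*, IV §10–11, Exercise 4.40) is obtained in the tree in two ways: from the
Ogg–Saito comparison of the Artin conductor of `V_ℓ E` with Ogg's formula
(`conductorNorm_eq_of_isIsogenous_of_tate`, granted the schema
`artinConductorExponent_tate_eq_conductorExponent_of_isElliptic`), and — here — **granted modularity**:
if every (globally minimal) elliptic curve over `ℚ` carries a modular parametrisation at level its
conductor (`nonempty_modularParametrizationData`, Breuil–Conrad–Diamond–Taylor), then for
`W ∼ W'` the newform of `W'` is a newform of `W` (isogenous curves have the same `L`-series,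
`IsNewformOf.of_isIsogenous`; Faltings) and two newforms of one curve have the same level
(`IsNewformOf.level_eq_level`, Atkin–Lehner 1970, Thm. 4 — strong multiplicity one, a theorem of the
tree), whence `N_W = N_{W'}`. The same three-line argument appears, for globally minimal models, in
`Summit.BirchSwinnertonDyer…conductorNorm_eq_of_isIsogenous_of_modular`; this file states it for
arbitrary models (passing to global minimal models, `hasGlobalMinimalModel_rat_holds`,
`conductorNorm_smul_rat`), for the use of the von Känel–Matschke chain
(`AbcHeightBoundFreyHellegouarchProofs`, `AbcAsymptoticHeightBoundProofs`), which already assumes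
modularity.

## References

* [AtkinLehner1970] A. O. L. Atkin, J. Lehner, *Hecke operators on `Γ₀(m)`*, Math. Ann. 185 (1970), Thm. 4.
* [BCDTJAMS2001] C. Breuil, B. Conrad, F. Diamond, R. Taylor, J. AMS 14 (2001), Theorem A.
* [SilvermanATAEC1994] J. H. Silverman, *Advanced Topics in the Arithmetic of Elliptic Curves*,
  IV §10 (PDF p. 364) and Exercise 4.40 (PDF p. 380).
-/

noncomputable section

open WeierstrassCurve

namespace Literature.NumberTheory.EllipticCurves.ModularForms

/-- **`N_W = N_{W'}` for `ℚ`-isogenous globally minimal elliptic curves, granted modularity**: the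
newform of `W'` is a newform of `W` (`IsNewformOf.of_isIsogenous`) and two newforms of `W` have the
same level (`IsNewformOf.level_eq_level`, Atkin–Lehner 1970 Thm. 4).
[cite: AtkinLehner1970, Thm. 4] [cite: SilvermanATAEC1994, Exercise 4.40 (PDF p. 380)] -/
theorem conductorNorm_eq_of_isIsogenous_of_modularity_of_isGloballyMinimal
    (hmod : nonempty_modularParametrizationData) {W W' : WeierstrassCurve ℚ} [W.IsElliptic]
    [W'.IsElliptic] [W.IsGloballyMinimal] [W'.IsGloballyMinimal] (hiso : W.IsIsogenous W') :
    W.conductorNorm ℤ = W'.conductorNorm ℤ := by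
  haveI : NeZero (W.conductorNorm ℤ) := ⟨(W.conductorNorm_pos_holds).ne'⟩
  haveI : NeZero (W'.conductorNorm ℤ) := ⟨(W'.conductorNorm_pos_holds).ne'⟩
  obtain ⟨D⟩ := hmod W
  obtain ⟨D'⟩ := hmod W'
  exact IsNewformOf.level_eq_level D.isNewformOf (D'.isNewformOf.of_isIsogenous hiso)

/-- **The conductor of an elliptic curve over `ℚ` is a `ℚ`-isogeny invariant, granted modularity**
(`nonempty_modularParametrizationData`): for arbitrary (not necessarily minimal) models `W ∼ W'`,
`N_W = N_{W'}`. Pass to global minimal models (`hasGlobalMinimalModel_rat_holds`; the conductor and the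
isogeny class are unchanged, `conductorNorm_smul_rat`, `isIsogenous_of_smul`/`isIsogenous_smul`) and
apply `conductorNorm_eq_of_isIsogenous_of_modularity_of_isGloballyMinimal`. In the shape of the schema
hypothesis consumed by `conductorNorm_eq_of_isIsogenous_of_tate`'s users.
[cite: SilvermanATAEC1994, Exercise 4.40 (PDF p. 380) with §IV.10 (PDF p. 364)] [cite: AtkinLehner1970, Thm. 4] -/
theorem conductorNorm_eq_of_isIsogenous_of_modularity (hmod : nonempty_modularParametrizationData)
    (W W' : WeierstrassCurve ℚ) [W.IsElliptic] [W'.IsElliptic] (hiso : W.IsIsogenous W') :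
    W.conductorNorm ℤ = W'.conductorNorm ℤ := by
  obtain ⟨C, hC⟩ := hasGlobalMinimalModel_rat_holds W
  obtain ⟨C', hC'⟩ := hasGlobalMinimalModel_rat_holds W'
  haveI := hC
  haveI := hC'
  rw [← conductorNorm_smul_rat W C, ← conductorNorm_smul_rat W' C']
  exact conductorNorm_eq_of_isIsogenous_of_modularity_of_isGloballyMinimal hmod
    (((isIsogenous_of_smul W C).trans' hiso).trans' (isIsogenous_smul W' C'))

end Literature.NumberTheory.EllipticCurves.ModularForms

end
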